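import Summits.RiemannHypothesis.RiemannHypothesis.Theorems.IntegerScrewFloorOfRHScrewSide
import Literature.NumberTheory.LFunctions.WeilLogLatticeComb
import Literature.NumberTheory.LFunctions.WeilExplicitFormulaProofs
import Literature.NumberTheory.LFunctions.WeilExplicitProofs
import Literature.NumberTheory.LFunctions.ZetaZerosProofs
import HarnessLib

/-!
# Crux `ScrewPolyFloor` (stmt-RiemannHypothesis-15757), line `weil_comb_floor`: stub S3
`stub_combDominated` (serves the route item `FloorOfRH`, stmt-RiemannHypothesis-15762)

Under RH the Weil form of the log-integer comb `g = Σ_{m ≤ M} y_m ε⁻¹ φ((· − log m)/ε)` is dominated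
by `‖φ'‖₁'² ε⁻²` times the screw form of `y` (for `Σ y = 0`):
`Re Q(g) ≤ weilL1(φ')² ε⁻² · Σ_{2≤m,m'≤M} G(log m, log m') y_m y_m'`.

Proof.  (i) `g` is a comb on the logarithmic lattice, hence a Weil test function
(`isWeilTest_logComb`), and by the PROVED explicit formula (`explicit_formula_holds`) applied to
`g ⋆ g̃`, `Re Q(g) = lim_T Re Σ_{ρ ∈ weilZeroIndex T} m(ρ) (g ⋆ g̃)^(ρ)`.  (ii) Under RH each index has
`Re ρ = 1/2`, so `(g ⋆ g̃)^(ρ) = |ĝ(ρ)|²` (`weilMellin_weilQuadratic_of_re_eq`), and by the comb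
transform (`weilMellin_logComb_cpow`, scale `λ = ε⁻¹`) `ĝ(ρ) = φ̂(1/2 + iεγ) · P_y(ρ)`,
`P_y(ρ) = Σ_{m ≤ M} y_m m^{ρ−1/2}`, with `|φ̂(1/2 + iεγ)| ≤ weilL1(φ')/(ε|γ|)` (one integration by
parts, `norm_weilMellin_half_add_le`).  (iii) Hence every truncated zero side is
`≤ weilL1(φ')² ε⁻² Σ_{ρ ∈ weilZeroIndex T} m(ρ)|P_y(ρ)|²/γ²`, a finite partial sum of the
non-negative family whose sum is the screw form (`IntegerScrew.hasSum_screwForm_of_RH`, the Gram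
expansion from Suzuki2023 (1.9)); `sum_le_hasSum` and `le_of_tendsto'` finish.
-/

-- `Summit.RiemannHypothesis.RiemannHypothesis.…` duplicates `RiemannHypothesis` BY DESIGN (D-0017).
set_option linter.dupNamespace false

noncomputable section

namespace Summit.RiemannHypothesis.RiemannHypothesis.Theorems.IntegerScrewScrewPolyFloor

open Literature.NumberTheory.LFunctions Complex Filter
open scoped BigOperators Topology
open Finset

/-- Re-indexing `range (M+1)` with a vanishing `0`-th coefficient onto `Icc 1 M`. -/
theorem sum_range_succ_eq_sum_Icc {F : ℕ → ℂ} (hF : F 0 = 0) (M : ℕ) :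
    ∑ m ∈ Finset.range (M + 1), F m = ∑ m ∈ Icc 1 M, F m := by
  rw [Finset.range_eq_Ico, Finset.sum_eq_sum_Ico_succ_bot (by omega : 0 < M + 1), hF, zero_add,
    zero_add, Finset.Ico_add_one_right_eq_Icc]

/-- **Stub S3 `stub_combDominated`** of line `weil_comb_floor` (crux `ScrewPolyFloor`,
stmt-RiemannHypothesis-15757; registered signature).  Under RH, for a Weil test function `φ`, `M ≥ 1`,
`ε > 0` and real `y` with `Σ_{m ≤ M} y_m = 0`, the Weil quadratic form of the comb
`x ↦ Σ_{m ≤ M} y_m ε⁻¹ φ((x − log m)/ε)` is at most `weilL1(φ')² ε⁻²` times the screw form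
`Σ_{2≤m,m'≤M} G(log m, log m') y_m y_m'`. -/
theorem stub_combDominated : _root_.RiemannHypothesis → ∀ φ : ℝ → ℂ, Literature.NumberTheory.LFunctions.IsWeilTest φ → ∀ (M : ℕ) (ε : ℝ) (y : ℕ → ℝ), 1 ≤ M → 0 < ε → ∑ m ∈ Finset.Icc 1 M, y m = 0 → (Literature.NumberTheory.LFunctions.weilQuadratic (fun x : ℝ => ∑ m ∈ Finset.Icc 1 M, ((y m : ℝ) : ℂ) * ((ε : ℂ)⁻¹ * φ ((x - Real.log (m : ℝ)) / ε)))).re ≤ Literature.NumberTheory.LFunctions.weilL1 (deriv φ) ^ 2 * ε⁻¹ ^ 2 * ∑ m ∈ Finset.Icc 2 M, ∑ m' ∈ Finset.Icc 2 M, Literature.NumberTheory.LFunctions.zetaScrewKernel (Real.log m) (Real.log m') * (y m * y m') := by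
  intro hRH φ hφ M ε y _hM hε hy
  classical
  -- the comb and its log-lattice form
  set g : ℝ → ℂ := fun x : ℝ => ∑ m ∈ Finset.Icc 1 M,
    ((y m : ℝ) : ℂ) * ((ε : ℂ)⁻¹ * φ ((x - Real.log (m : ℝ)) / ε)) with hg_def
  set c : ℕ → ℂ := fun m => if m = 0 then 0 else ((y m : ℝ) : ℂ) * (ε : ℂ)⁻¹ with hc
  have hc0 : c 0 = 0 := by simp [hc]
  have hg_eq : g = fun u => ∑ m ∈ Finset.range (M + 1), c m * φ ((u - Real.log m) * ε⁻¹) := by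
    funext u
    rw [sum_range_succ_eq_sum_Icc (by rw [hc0, zero_mul]) M, hg_def]
    refine Finset.sum_congr rfl fun m hm => ?_
    have hm0 : m ≠ 0 := by
      simp only [Finset.mem_Icc] at hm; omega
    simp only [hc, if_neg hm0, div_eq_mul_inv]
    ring
  have hgW : IsWeilTest g := by
    rw [hg_eq]
    exact isWeilTest_logComb hφ c (M + 1) (inv_ne_zero hε.ne')
  -- the explicit formula for `g ⋆ g̃`
  have hk : IsWeilTest (weilConv g (weilReflect g)) := hgW.weilConv hgW.weilReflect
  have hlim : Tendsto (fun T => (weilZeroSidePartial (weilConv g (weilReflect g)) T).re) atTop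
      (𝓝 (weilQuadratic g).re) :=
    (Complex.continuous_re.tendsto _).comp (explicit_formula_holds hk)
  -- names for the bound
  set Bφ : ℝ := weilL1 (deriv φ) ^ 2 * ε⁻¹ ^ 2 with hBφ
  set F : ℂ → ℝ := fun ρ => (riemannZetaZeroOrder ρ : ℝ) / ρ.im ^ 2 *
    ‖∑ m ∈ Icc 1 M, ((y m : ℝ) : ℂ) * (m : ℂ) ^ (ρ - 1 / 2)‖ ^ 2 with hF
  have hScrew := IntegerScrew.hasSum_screwForm_of_RH hRH M y hy
  have hBφ0 : 0 ≤ Bφ := by positivity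
  refine le_of_tendsto' hlim fun T => ?_
  -- the truncated zero side at height `T`
  have hfin := weilZeroIndex_finite T
  unfold weilZeroSidePartial
  rw [finsum_mem_eq_finite_toFinset_sum _ hfin, Complex.re_sum]
  -- pointwise: each term is real, `= m(ρ)|ĝ(ρ)|²`, and `≤ Bφ · F ρ`
  have hpt : ∀ ρ ∈ hfin.toFinset,
      ((riemannZetaZeroOrder ρ : ℂ) * weilMellin (weilConv g (weilReflect g)) ρ).re ≤ Bφ * F ρ := by
    intro ρ hρ
    rw [Set.Finite.mem_toFinset] at hρ
    obtain ⟨hζ, -, -, him, -⟩ := hρ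
    have hne : ρ ≠ 1 := by
      rintro rfl
      simp at him
    have hre : ρ.re = 1 / 2 := by
      refine hRH ρ hζ ?_ hne
      rintro ⟨n, rfl⟩
      simp at him
    have hNZ : ρ ∈ ZetaZeros.riemannZetaNontrivialZeros :=
      mem_riemannZetaNontrivialZeros_iff_holds.2 ⟨hζ, by rw [hre]; norm_num, by rw [hre]; norm_num⟩
    have hm0 : (0 : ℝ) ≤ (riemannZetaZeroOrder ρ : ℝ) := by
      exact_mod_cast riemannZetaZeroOrder_nonneg hne
    rw [weilMellin_weilQuadratic_of_re_eq hgW hre, ← Complex.ofReal_intCast, ← Complex.ofReal_mul,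
      Complex.ofReal_re]
    -- the transform of the comb at `ρ`
    set P : ℂ := ∑ m ∈ Icc 1 M, ((y m : ℝ) : ℂ) * (m : ℂ) ^ (ρ - 1 / 2) with hP
    have hsub : ρ - 1 / 2 = ((ρ.im : ℝ) : ℂ) * I :=
      ZetaScrewThm17.sub_half_eq_of_RH hRH hNZ
    have hMel : weilMellin g ρ = weilMellin φ (1 / 2 + ((ρ.im * ε : ℝ) : ℂ) * I) * P := by
      rw [hg_eq, weilMellin_logComb_cpow hφ hc0 (M + 1) (inv_pos.2 hε) ρ]
      have hsum : ∑ m ∈ Finset.range (M + 1), c m * (m : ℂ) ^ (ρ - 1 / 2) = (ε : ℂ)⁻¹ * P := by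
        rw [sum_range_succ_eq_sum_Icc (by rw [hc0, zero_mul]) M, hP, Finset.mul_sum]
        refine Finset.sum_congr rfl fun m hm => ?_
        have hm0' : m ≠ 0 := by
          simp only [Finset.mem_Icc] at hm; omega
        simp only [hc, if_neg hm0']
        ring
      rw [hsum]
      have hε0 : (ε : ℂ) ≠ 0 := Complex.ofReal_ne_zero.2 hε.ne'
      have harg : (1 : ℂ) / 2 + (ρ - 1 / 2) / ((ε⁻¹ : ℝ) : ℂ) = 1 / 2 + ((ρ.im * ε : ℝ) : ℂ) * I := by
        rw [hsub]
        push_cast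
        field_simp
      rw [harg]
      push_cast
      field_simp
    -- decay of `φ̂` one step into the strip
    have hγ : ρ.im ≠ 0 := him
    have hdec : ‖weilMellin φ (1 / 2 + ((ρ.im * ε : ℝ) : ℂ) * I)‖ ≤
        weilL1 (deriv φ) / (|ρ.im| * ε) := by
      have hz_re : |(((ρ.im * ε : ℝ) : ℂ) * I).re| ≤ 1 / 2 := by simp
      have hz_im : (((ρ.im * ε : ℝ) : ℂ) * I).im ≠ 0 := by
        simp [hγ, hε.ne']
      have h := norm_weilMellin_half_add_le hφ 1 hz_re hz_im
      simp only [Function.iterate_one, pow_one] at h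
      have e : |(((ρ.im * ε : ℝ) : ℂ) * I).im| = |ρ.im| * ε := by
        simp [abs_mul, abs_of_pos hε]
      rwa [e] at h
    -- assemble the pointwise bound
    have hnormSq : Complex.normSq (weilMellin g ρ) = ‖weilMellin g ρ‖ ^ 2 := (Complex.sq_norm _).symm
    rw [hnormSq, hMel, norm_mul]
    have hden : 0 < |ρ.im| * ε := mul_pos (abs_pos.2 hγ) hε
    have h1 : ‖weilMellin φ (1 / 2 + ((ρ.im * ε : ℝ) : ℂ) * I)‖ * ‖P‖ ≤
        weilL1 (deriv φ) / (|ρ.im| * ε) * ‖P‖ :=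
      mul_le_mul_of_nonneg_right hdec (norm_nonneg _)
    have h2 : (‖weilMellin φ (1 / 2 + ((ρ.im * ε : ℝ) : ℂ) * I)‖ * ‖P‖) ^ 2 ≤
        (weilL1 (deriv φ) / (|ρ.im| * ε) * ‖P‖) ^ 2 :=
      pow_le_pow_left₀ (mul_nonneg (norm_nonneg _) (norm_nonneg _)) h1 2
    have h3 : (weilL1 (deriv φ) / (|ρ.im| * ε) * ‖P‖) ^ 2 = Bφ * (1 / ρ.im ^ 2 * ‖P‖ ^ 2) := by
      rw [hBφ]
      have hγ2 : ρ.im ^ 2 = |ρ.im| ^ 2 := (sq_abs _).symm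
      rw [hγ2]
      field_simp
    calc (riemannZetaZeroOrder ρ : ℝ) *
          (‖weilMellin φ (1 / 2 + ((ρ.im * ε : ℝ) : ℂ) * I)‖ * ‖P‖) ^ 2
        ≤ (riemannZetaZeroOrder ρ : ℝ) * (Bφ * (1 / ρ.im ^ 2 * ‖P‖ ^ 2)) := by
          rw [← h3]; exact mul_le_mul_of_nonneg_left h2 hm0
      _ = Bφ * F ρ := by rw [hF]; ring
  -- sum the pointwise bounds and compare with the full (non-negative) series
  have hsumF : ∑ ρ ∈ hfin.toFinset, F ρ ≤
      ∑ m ∈ Finset.Icc 2 M, ∑ m' ∈ Finset.Icc 2 M,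
        zetaScrewKernel (Real.log m) (Real.log m') * (y m * y m') := by
    have hmem : ∀ ρ ∈ hfin.toFinset, ρ ∈ ZetaZeros.riemannZetaNontrivialZeros := by
      intro ρ hρ
      rw [Set.Finite.mem_toFinset] at hρ
      obtain ⟨hζ, -, -, him, -⟩ := hρ
      have hne : ρ ≠ 1 := by
        rintro rfl
        simp at him
      have hre : ρ.re = 1 / 2 := by
        refine hRH ρ hζ ?_ hne
        rintro ⟨n, rfl⟩
        simp at him
      exact mem_riemannZetaNontrivialZeros_iff_holds.2
        ⟨hζ, by rw [hre]; norm_num, by rw [hre]; norm_num⟩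
    rw [← Finset.sum_subtype_of_mem F hmem]
    refine sum_le_hasSum _ (fun ρ _ => ?_) hScrew
    exact mul_nonneg (div_nonneg (by
      have h1 := ZetaZeros.riemannZetaNontrivialZeros.one_le_order ρ.2
      exact_mod_cast (show (0 : ℤ) ≤ riemannZetaZeroOrder (ρ : ℂ) by omega)) (sq_nonneg _))
      (sq_nonneg _)
  calc ∑ ρ ∈ hfin.toFinset,
        ((riemannZetaZeroOrder ρ : ℂ) * weilMellin (weilConv g (weilReflect g)) ρ).re
      ≤ ∑ ρ ∈ hfin.toFinset, Bφ * F ρ := Finset.sum_le_sum hpt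
    _ = Bφ * ∑ ρ ∈ hfin.toFinset, F ρ := by rw [Finset.mul_sum]
    _ ≤ Bφ * ∑ m ∈ Finset.Icc 2 M, ∑ m' ∈ Finset.Icc 2 M,
          zetaScrewKernel (Real.log m) (Real.log m') * (y m * y m') :=
        mul_le_mul_of_nonneg_left hsumF hBφ0

end Summit.RiemannHypothesis.RiemannHypothesis.Theorems.IntegerScrewScrewPolyFloor

end
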